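import Literature.Probability.RandomPlanarGeometry.SLESixMoebiusLocality
import Literature.Probability.RandomPlanarGeometry.SLESixSplitting
import Literature.Probability.RandomPlanarGeometry.CurveClassStopAtMeasurable
import Literature.Probability.RandomPlanarGeometry.SLETargetIndependenceSix
import Literature.Probability.RandomPlanarGeometry.SLERestrictionLocal
import Literature.Probability.RandomPlanarGeometry.SLETransienceKappaEightHolds
import Literature.Probability.RandomPlanarGeometry.CritPercSLESwallowedProofs
import Literature.Probability.RandomPlanarGeometry.SLETraceMeasurable
import Literature.Probability.RandomPlanarGeometry.ConformalRestrictionProofs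
import Literature.Probability.RandomPlanarGeometry.CaratheodoryHalfPlaneProofs
import HarnessLib

/-!
# The splitting property of chordal SLE₆ in Jordan domains, reduced to the half-plane

Topic `Probability/RandomPlanarGeometry`; theorems only (no definition, no new named fact).
G. F. Lawler, *Conformally Invariant Processes in the Plane* (2005), §6.3, Prop. 6.14: "Suppose
`D` is a Jordan domain and `z, w, w'` are distinct boundary points. Consider chordal SLE₆ from `z`
to `w` and chordal SLE₆ from `z` to `w'`, both in `D`. Then (modulo change of time) the two
processes have the same distribution up to the first time they reach the arc of `∂D` between `w`
and `w'` not containing `z`" — obtained from the half-plane computation (Thm. 6.13 applied to the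
Möbius map `Φ_x(z) = zx/(z+x)`) "by conformal invariance". This file PROVES that step in the tree:

* `IsSLELaw.targetIndependence_six_of_moebius` — the named fact
  `IsSLELaw.targetIndependence_six` (`SLESixSplitting.lean`; Lawler–Schramm–Werner (2001)
  Cor. 2.3 / Werner (2007) Prop. 3.4 transposed to `IsSLELaw` and `CurveClass.stopAt`) follows
  from its half-plane form `sle_six_moebius_locality` (`SLESixMoebiusLocality.lean`);
* `ChordalFamily.isTargetIndependent_of_isSLELaw_six_of_moebius` — hence every family of chordal
  SLE₆ laws is target independent (`ChordalFamily.IsTargetIndependent`), given the half-plane fact.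

Proof (`measure_stopAt_preimage_eq_of_moebius`). Write the law `μ₂` of `(D; p₀, p₂)` as the law
of the compactified image of the SLE₆ trace `γ` under the boundary extension `Ψ₂` of its chordal
map `ψ : ℍ → D`; the arc `[p₁, p₂] = D.arc 1` pulls back to the closed real ray from
`x = Ψ₂⁻¹(p₁) ≠ 0` (`ConformalRectangle.boundaryExtension_mem_arc_iff`, through the auxiliary
rectangle `(D; p₀, p₁, p₂, q)` exactly as in `SLETargetIndependenceSix`). The re-targeted map
`ψ ∘ Φ_x` uniformizes `(D; p₀, p₁)` (`retargetMoebius.isChordalUniformizing_trans`), so by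
uniqueness of the SLE law (`IsSLELaw.eq_map_of_isSLECurve`) `μ₁` is the law of the compactified
image of `γ` under `Ψ₂ ∘ Φ_x` (`exists_isSLECurve_through_of_ae_tendsto`; Rohde–Schramm trace and
transience theorems for `κ = 6`, Carathéodory continuity, measurability of the trace — all proved
in the tree), under which `[p₁, p₂]` pulls back to the ray from the pole `-x`
(`retargetMoebius.mem_realRay_iff`; the trace a.s. avoids `-x`, `ae_ofReal_notMem_range_sleTrace`).
Stopping both compactified images on `[p₁, p₂]` (`mk_stopAt_eq_stoppedPathClass`; the hitting
times are a.s. finite, `ae_sle_swallowingTime_ofReal_lt_top` with Lawler's Rem. 6.6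
`sle_swallowingTime_ofReal_eq_firstHit_holds`) exhibits the two events as the half-plane events of
`sle_six_moebius_locality` tested on the preimage of `T` under the continuous map
`CurveClass.map Ψ₂♯`, `Ψ₂♯` a continuous extension of `Ψ₂` to `ℂ`
(`exists_continuousMap_eq_of_continuousOn_closure`); the sets `stopAt (D.arc 1) ⁻¹' T` are Borel
(`CurveClass.map_apply_stopAt_preimage`).

## References

* G. F. Lawler, *Conformally Invariant Processes in the Plane*, AMS (2005), §6.3, Prop. 6.14.
  [Lawler2005]
* G. F. Lawler, O. Schramm, W. Werner, Acta Math. 187 (2001), Cor. 2.3. [LawlerSchrammWerner2001]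
* W. Werner, *Lectures on two-dimensional critical percolation* (2007), Prop. 3.4. [Werner2007]
-/

noncomputable section

open Set Filter Topology MeasureTheory Complex
open UpperHalfPlane (upperHalfPlaneSet)
open scoped NNReal unitInterval

namespace Literature.Probability.RandomPlanarGeometry

open Literature.Probability.Process

/-! ### Continuous extension across the real axis -/

/-- **A function continuous on the closed upper half-plane extends to a continuous function on
`ℂ`** agreeing with it on the closed half-plane (fold the lower half-plane up:
`z ↦ Φ(re z + i |im z|)`). [folklore] -/
theorem exists_continuousMap_eq_of_continuousOn_closure {Φ : ℂ → ℂ}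
    (hΦ : ContinuousOn Φ (closure upperHalfPlaneSet)) :
    ∃ Ψ : C(ℂ, ℂ), ∀ z : ℂ, 0 ≤ z.im → Ψ z = Φ z := by
  have hcl : closure upperHalfPlaneSet = {w : ℂ | 0 ≤ w.im} := Complex.closure_setOf_lt_im 0
  have hf : Continuous fun z : ℂ ↦ (⟨z.re, |z.im|⟩ : ℂ) := by
    have : (fun z : ℂ ↦ (⟨z.re, |z.im|⟩ : ℂ)) =
        fun z ↦ Complex.equivRealProdCLM.symm (z.re, |z.im|) := by
      funext z
      rfl
    rw [this]
    exact Complex.equivRealProdCLM.symm.continuous.comp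
      (continuous_re.prodMk (continuous_abs.comp continuous_im))
  refine ⟨⟨fun z ↦ Φ ⟨z.re, |z.im|⟩, hΦ.comp_continuous hf fun z ↦ ?_⟩, fun z hz ↦ ?_⟩
  · rw [hcl]
    exact abs_nonneg z.im
  · change Φ ⟨z.re, |z.im|⟩ = Φ z
    congr 1
    exact Complex.ext rfl (abs_of_nonneg hz)

/-- The paths of the SLE trace generating the chain lie in the closed half-plane, so a function
continuous on the closed half-plane is continuous along them. [folklore] -/
theorem continuous_comp_of_isGeneratedByCurve {Φ : ℂ → ℂ} {W : ℝ≥0 → ℝ} {γ : ℝ≥0 → ℂ}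
    (hΦ : ContinuousOn Φ (closure upperHalfPlaneSet)) (hgen : Loewner.IsGeneratedByCurve W γ) :
    Continuous fun t : ℝ ↦ Φ (γ t.toNNReal) := by
  have hcl : closure upperHalfPlaneSet = {w : ℂ | 0 ≤ w.im} := Complex.closure_setOf_lt_im 0
  exact hΦ.comp_continuous (hgen.continuous.comp continuous_real_toNNReal) fun t ↦ by
    rw [hcl]; exact hgen.im_nonneg _

/-! ### The reduction -/

/-- **Core of the reduction** (for a fixed chordal map `ψ` of `(D; p₀, p₂)` realising the law
towards `p₂`): the stopped law towards `p₁` equals the stopped law towards `p₂`, given the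
half-plane fact. See `IsSLELaw.targetIndependence_six_of_moebius`. [cite: Lawler2005, §6.3 Prop. 6.14] -/
theorem measure_stopAt_preimage_eq_of_moebius (hM : sle_six_moebius_locality) (D : MarkedDomain 3)
    {Γ₂ : (ℝ≥0 → ℝ) → CurveClass ℂ} (hΓ₂m : AEMeasurable Γ₂ preWienerMeasure)
    (ψ : ConformalEquiv upperHalfPlaneSet D.carrier)
    (hψ : (D.chord 0 2 (by decide)).IsChordalUniformizing ψ)
    (hae₂ : ∀ᵐ ω ∂preWienerMeasure, Loewner.IsGeneratedByCurve (sleDriving 6 ω) (sleTrace 6 ω) ∧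
      ∃ c : Curve ℂ, Γ₂ ω = CurveClass.mk c ∧
        IsCompactifiedImage ψ.boundaryExtension (sleTrace 6 ω) (D.pt 2) c)
    {μ₁ : Measure (CurveClass ℂ)} (hμ₁ : IsSLELaw 6 (D.chord 0 1 (by decide)) μ₁)
    {T : Set (CurveClass ℂ)} (hT : MeasurableSet T) :
    μ₁ (CurveClass.stopAt (D.arc 1) ⁻¹' T) =
      preWienerMeasure.map Γ₂ (CurveClass.stopAt (D.arc 1) ⁻¹' T) := by
  have hC := JordanDomain.exists_continuousOn_extension_holds
  have hext := JordanDomain.continuousOn_boundaryExtension_holds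
  have h6₄ : (4 : ℝ≥0) < 6 := by norm_num
  have h6₈ : (6 : ℝ≥0) < 8 := by norm_num
  have hTr : HasSLETrace 6 := hae₂.mono fun ω hω ↦ ⟨_, hω.1⟩
  -- boundary bookkeeping through the rectangle `(D; p₀, p₁, p₂, q)`
  have h01 : D.mark 0 < D.mark 1 := D.strictMono_mark (by decide)
  have h12 : D.mark 1 < D.mark 2 := D.strictMono_mark (by decide)
  have hm2 := (D.mark_mem 2).2
  let R' : ConformalRectangle :=
    { toJordanDomain := D.toJordanDomain
      mark := ![D.mark 0, D.mark 1, D.mark 2, (D.mark 2 + 1) / 2]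
      strictMono_mark := Fin.strictMono_iff_lt_succ.2 fun i ↦ by
        fin_cases i
        · exact h01
        · exact h12
        · show D.mark 2 < (D.mark 2 + 1) / 2
          linarith
      mark_mem := fun i ↦ by
        fin_cases i
        · exact D.mark_mem 0
        · exact D.mark_mem 1
        · exact D.mark_mem 2
        · show (D.mark 2 + 1) / 2 ∈ Ico (0 : ℝ) 1
          exact ⟨by linarith [(D.mark_mem 2).1], by linarith⟩ }
  have hR'arc : R'.arc 1 = D.arc 1 := by
    rw [ConformalRectangle.arc_one_eq, MarkedDomain.arc_one_three]
    rfl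
  have h₀₂ : ψ.HasBoundaryValue 0 (R'.pt 0) := hψ.1
  have h₂₂ : ψ.HasBoundaryValueAtInfty (R'.pt 2) := hψ.2
  obtain ⟨Φ₂, hΦ₂⟩ := JordanDomain.exists_isDiscExtension (D := R'.toJordanDomain) hC ψ
  set g := JordanDomain.discParam R'.toJordanDomain Φ₂ with hg
  set x : ℝ := g (D.mark 1) with hxdef
  have hx0 : x ≠ 0 := by
    rcases ConformalRectangle.discParam_signs hΦ₂ h₂₂ h₀₂ with ⟨-, h⟩ | ⟨h, -⟩
    · exact h.ne'
    · exact h.ne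
  have hnx0 : -x ≠ 0 := neg_ne_zero.2 hx0
  have hrayF : ∀ z : ℂ, 0 ≤ z.im → (ψ.boundaryExtension z ∈ D.arc 1 ↔ z ∈ realRay x) :=
    fun z hz ↦ by
      rw [← hR'arc]
      exact (ConformalRectangle.boundaryExtension_mem_arc_iff hΦ₂ h₂₂ h₀₂ hz).1
  have hv : ψ.HasBoundaryValue x (D.pt 1) :=
    ConformalRectangle.hasBoundaryValue_discParam_mark_one hΦ₂ h₂₂
  -- the law towards `p₁` through the re-targeted chordal map `ψ ∘ Φ_x`
  set φ₁ : ConformalEquiv upperHalfPlaneSet D.carrier := (retargetMoebiusEquiv x hx0).trans ψ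
    with hφ₁def
  have hφ₁ : (D.chord 0 1 (by decide)).IsChordalUniformizing φ₁ :=
    retargetMoebius.isChordalUniformizing_trans hx0 hψ hv
  obtain ⟨Γ₁, hΓ₁m, hae₁⟩ := exists_isSLECurve_through_of_ae_tendsto (D := D.chord 0 1 (by decide))
    hTr (tendsto_norm_sleTrace_atTop_of_ne_eight (κ := 6) (by norm_num) (by norm_num)) hext
    (aemeasurable_sleTrace_holds hTr) hφ₁
  have hμ₁eq : μ₁ = preWienerMeasure.map Γ₁ :=
    hμ₁.eq_map_of_isSLECurve (IsSLECurve.of_through hφ₁ hΓ₁m hae₁)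
  rw [hμ₁eq, CurveClass.map_apply_stopAt_preimage hΓ₁m (D.isClosed_arc 1) hT,
    CurveClass.map_apply_stopAt_preimage hΓ₂m (D.isClosed_arc 1) hT]
  -- a continuous extension of `Ψ₂ = ψ.boundaryExtension` to `ℂ`, and the transported test set
  obtain ⟨Ψs, hΨs⟩ := exists_continuousMap_eq_of_continuousOn_closure (hext D.toJordanDomain ψ)
  set T' : Set (CurveClass ℂ) := CurveClass.map Ψs ⁻¹' T with hT'def
  have hT' : MeasurableSet T' := hT.preimage (CurveClass.measurable_map Ψs)
  have key := hM x hx0 T' hT'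
  -- a.e. identification of the two events with the half-plane events
  have hcastneg : (((-x : ℝ) : ℂ)) = -(x : ℂ) := Complex.ofReal_neg x
  have h1 : Γ₁ ⁻¹' (CurveClass.stopAt (D.arc 1) ⁻¹' T) =ᵐ[preWienerMeasure]
      {ω | stoppedPathClass (retargetMoebius x) (sleTrace 6 ω)
        ((firstHit (sleTrace 6 ω) (realRay (-x))).untopD 0) ∈ T'} := by
    filter_upwards [hae₁, ae_sle_swallowingTime_ofReal_lt_top h6₄ hnx0,
      ae_ofReal_notMem_range_sleTrace h6₄ h6₈ hnx0] with ω hω hfin hpole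
    obtain ⟨hgen, c₁, hΓ₁c, hc₁⟩ := hω
    have hTeq := sle_swallowingTime_ofReal_eq_firstHit_holds 6 ω hgen hnx0
    rw [hTeq] at hfin
    obtain ⟨τ, hτ, -⟩ := exists_firstHit_eq_coe hgen.continuous (isClosed_realRay _) hfin.ne
    have hne : ∀ t, sleTrace 6 ω t ≠ -x := fun t h ↦ hpole ⟨t, by rw [hcastneg]; exact h⟩
    have him := hgen.im_nonneg
    refine propext ?_
    change Γ₁ ω ∈ CurveClass.stopAt (D.arc 1) ⁻¹' T ↔
      stoppedPathClass (retargetMoebius x) (sleTrace 6 ω)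
        ((firstHit (sleTrace 6 ω) (realRay (-x))).untopD 0) ∈ CurveClass.map Ψs ⁻¹' T
    rw [hΓ₁c, mem_preimage, CurveClass.stopAt_mk_holds _ (D.isClosed_arc 1), mem_preimage, hτ,
      WithTop.untopD_coe]
    -- stop the compactified image
    have hext₁ : ∀ t, φ₁.boundaryExtension (sleTrace 6 ω t) =
        ψ.boundaryExtension (retargetMoebius x (sleTrace 6 ω t)) := fun t ↦
      retargetMoebius.boundaryExtension_trans hx0 ψ (hext _ ψ) (him t) (hne t)
    have hΨF : ∀ t, φ₁.boundaryExtension (sleTrace 6 ω t) ∈ D.arc 1 ↔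
        sleTrace 6 ω t ∈ realRay (-x) := fun t ↦ by
      rw [hext₁ t, hrayF _ (retargetMoebius.im_nonneg (hne t) (him t)),
        retargetMoebius.mem_realRay_iff hx0 (hne t) (him t)]
    have hcontφ := continuous_comp_of_isGeneratedByCurve (hext _ φ₁) hgen
    have hA := mk_stopAt_eq_stoppedPathClass (D.isClosed_arc 1) (isClosed_realRay (-x))
      hgen.continuous hΨF hc₁ hτ hcontφ.continuousOn
    rw [hA]
    -- compare the two stopped image paths pointwise
    have hcontL : Continuous (fun s : I ↦ φ₁.boundaryExtension
        (sleTrace 6 ω (((τ : ℝ) * s).toNNReal))) :=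
      hcontφ.comp (continuous_const.mul continuous_subtype_val)
    have hcontR : Continuous (fun s : I ↦ retargetMoebius x
        (sleTrace 6 ω (((τ : ℝ) * s).toNNReal))) :=
      retargetMoebius.continuousOn.comp_continuous
        (hgen.continuous.comp (continuous_real_toNNReal.comp
          (continuous_const.mul continuous_subtype_val))) fun s ↦ hne _
    rw [stoppedPathClass_eq hcontL, stoppedPathClass_eq hcontR, CurveClass.map_mk]
    have heq : (⟨⟨fun s : I ↦ φ₁.boundaryExtension (sleTrace 6 ω (((τ : ℝ) * s).toNNReal)),
        hcontL⟩⟩ : Curve ℂ) =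
        Curve.map Ψs ⟨⟨fun s : I ↦ retargetMoebius x (sleTrace 6 ω (((τ : ℝ) * s).toNNReal)),
          hcontR⟩⟩ := by
      refine Curve.ext (ContinuousMap.ext fun s ↦ ?_)
      change φ₁.boundaryExtension (sleTrace 6 ω (((τ : ℝ) * s).toNNReal)) =
        Ψs (retargetMoebius x (sleTrace 6 ω (((τ : ℝ) * s).toNNReal)))
      rw [hΨs _ (retargetMoebius.im_nonneg (hne _) (him _)), hext₁]
    rw [heq]
  have h2 : Γ₂ ⁻¹' (CurveClass.stopAt (D.arc 1) ⁻¹' T) =ᵐ[preWienerMeasure]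
      {ω | stoppedPathClass id (sleTrace 6 ω)
        ((firstHit (sleTrace 6 ω) (realRay x)).untopD 0) ∈ T'} := by
    filter_upwards [hae₂, ae_sle_swallowingTime_ofReal_lt_top h6₄ hx0] with ω hω hfin
    obtain ⟨hgen, c₂, hΓ₂c, hc₂⟩ := hω
    have hTeq := sle_swallowingTime_ofReal_eq_firstHit_holds 6 ω hgen hx0
    rw [hTeq] at hfin
    obtain ⟨τ, hτ, -⟩ := exists_firstHit_eq_coe hgen.continuous (isClosed_realRay _) hfin.ne
    have him := hgen.im_nonneg
    refine propext ?_
    change Γ₂ ω ∈ CurveClass.stopAt (D.arc 1) ⁻¹' T ↔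
      stoppedPathClass id (sleTrace 6 ω)
        ((firstHit (sleTrace 6 ω) (realRay x)).untopD 0) ∈ CurveClass.map Ψs ⁻¹' T
    rw [hΓ₂c, mem_preimage, CurveClass.stopAt_mk_holds _ (D.isClosed_arc 1), mem_preimage, hτ,
      WithTop.untopD_coe]
    have hΨF : ∀ t, ψ.boundaryExtension (sleTrace 6 ω t) ∈ D.arc 1 ↔
        sleTrace 6 ω t ∈ realRay x := fun t ↦ hrayF _ (him t)
    have hcontψ := continuous_comp_of_isGeneratedByCurve (hext _ ψ) hgen
    have hA := mk_stopAt_eq_stoppedPathClass (D.isClosed_arc 1) (isClosed_realRay x)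
      hgen.continuous hΨF hc₂ hτ hcontψ.continuousOn
    rw [hA]
    have hcontL : Continuous (fun s : I ↦ ψ.boundaryExtension
        (sleTrace 6 ω (((τ : ℝ) * s).toNNReal))) :=
      hcontψ.comp (continuous_const.mul continuous_subtype_val)
    have hcontR := continuous_stoppedPath_id hgen.continuous τ
    rw [stoppedPathClass_eq hcontL, stoppedPathClass_eq hcontR, CurveClass.map_mk]
    have heq : (⟨⟨fun s : I ↦ ψ.boundaryExtension (sleTrace 6 ω (((τ : ℝ) * s).toNNReal)),
        hcontL⟩⟩ : Curve ℂ) =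
        Curve.map Ψs ⟨⟨fun s : I ↦ id (sleTrace 6 ω (((τ : ℝ) * s).toNNReal)), hcontR⟩⟩ := by
      refine Curve.ext (ContinuousMap.ext fun s ↦ ?_)
      change ψ.boundaryExtension (sleTrace 6 ω (((τ : ℝ) * s).toNNReal)) =
        Ψs (id (sleTrace 6 ω (((τ : ℝ) * s).toNNReal)))
      rw [id, hΨs _ (him _)]
    rw [heq]
  rw [measure_congr h1, measure_congr h2]
  exact key

/-- **Reduction of the splitting property to the half-plane** (Lawler (2005), Prop. 6.14 from
§6.3, "by conformal invariance"): the named fact `IsSLELaw.targetIndependence_six`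
(`SLESixSplitting`, LSW (2001) Cor. 2.3 / Werner (2007) Prop. 3.4) follows from its half-plane
form `sle_six_moebius_locality`. Given chordal SLE₆ laws `μ₁` of `(D; p₀, p₁)` and `μ₂` of
`(D; p₀, p₂)`: write `μ₂` as the law of the compactified image of the SLE₆ trace `γ` under the
boundary extension `Ψ₂` of its chordal map `ψ : ℍ → D` (`0 ↦ p₀`, `∞ ↦ p₂`); the arc `[p₁, p₂]`
pulls back to the closed real ray from `x = Ψ₂⁻¹(p₁) ≠ 0` (boundary correspondence,
`ConformalRectangle.boundaryExtension_mem_arc_iff`); `ψ ∘ Φ_x` is a chordal map of `(D; p₀, p₁)`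
(`retargetMoebius.isChordalUniformizing_trans`), so by uniqueness of the SLE law `μ₁` is the law
of the compactified image of `γ` under `Ψ₂ ∘ Φ_x` (`exists_isSLECurve_through_of_ae_tendsto`,
`IsSLELaw.eq_map_of_isSLECurve`), under which `[p₁, p₂]` pulls back to the ray from the pole `-x`
(`retargetMoebius.mem_realRay_iff`; the trace a.s. avoids `-x`, `ae_ofReal_notMem_range_sleTrace`).
Stopping the two compactified images on `[p₁, p₂]` gives `Ψ₂`-images of the stopped paths
`Φ_x ∘ γ|[0, T₋]`, `γ|[0, T₊]` (`mk_stopAt_eq_stoppedPathClass`; both times a.s. finite,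
`ae_sle_swallowingTime_ofReal_lt_top` with Lawler's Rem. 6.6
`sle_swallowingTime_ofReal_eq_firstHit_holds`), whose laws agree by the half-plane fact, tested
on the preimage of `T` under the continuous map `CurveClass.map Ψ₂♯` (`Ψ₂♯` a continuous
extension of `Ψ₂` to `ℂ`). The sets `stopAt (D.arc 1) ⁻¹' T` are Borel
(`CurveClass.measurableSet_stopAt_preimage`). [cite: Lawler2005, §6.3 Prop. 6.14] -/
theorem IsSLELaw.targetIndependence_six_of_moebius (hM : sle_six_moebius_locality) :
    IsSLELaw.targetIndependence_six := by
  intro D μ₁ μ₂ hμ₁ hμ₂ T hT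
  obtain ⟨Γ₂, ⟨hΓ₂m, ψ, hψ, hae₂⟩, rfl⟩ := hμ₂
  exact measure_stopAt_preimage_eq_of_moebius hM D hΓ₂m ψ hψ hae₂ hμ₁ hT

/-- **Target independence of every family of chordal SLE₆ laws, from the half-plane fact.**
[cite: Lawler2005, §6.3 Prop. 6.14] -/
theorem ChordalFamily.isTargetIndependent_of_isSLELaw_six_of_moebius (hM : sle_six_moebius_locality)
    {Q : ChordalFamily} (hQ : ∀ D : DobrushinDomain, IsSLELaw 6 D (Q D)) :
    Q.IsTargetIndependent :=
  ChordalFamily.isTargetIndependent_of_isSLELaw_six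
    (IsSLELaw.targetIndependence_six_of_moebius hM) hQ


end Literature.Probability.RandomPlanarGeometry

end
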